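import Mathlib
import Literature.Probability.LatticeModels.GKSInequalities
import Literature.Probability.LatticeModels.IsingInverseMCertificate
import Literature.Probability.LatticeModels.IsingInverseMCertificateSound
import Literature.Probability.LatticeModels.IsingInverseMCertificateSym
import HarnessLib

/-!
# Multi-class inverse-M certificates (couplings constant on edge classes, every class free)

The certificate checkers `IsingPolynomial.check` / `checkSym` / `checkAuto` certify
`(Σ⁻¹)_{xy} ≤ 0` (`x ≠ y`) for the zero-field Ising model on a finite graph `(Fin n, E)` with the
SAME coupling `K ≥ 0` on every edge.  This file is the generic layer of a checker for the next
level: the edges are partitioned into classes (`cls[i] ∈ ℕ` is the class of edge `i`), edge `i`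
carries the coupling `K_{cls i}`, and the conclusion is certified for ALL `(K_c)_c ≥ 0`
SIMULTANEOUSLY (the system `gksExpect univ (fun i => K (cls i)) (edgeSet n E)` of Friedli–Velenik
2017 §3.8.1; the inverse-M question of Lauritzen–Uhler–Zwiernik 2021 §5 for anisotropic /
direction-dependent couplings). [cite: LauritzenUhlerZwiernik2021, §5]

Put `v_c := e^{2K_c} − 1 ≥ 0`.  Exactly as in the one-variable case, `Z·Σ = (∏_i e^{−K_{cls i}}) ·
M(v)` with the multivariate Edwards–Sokal matrix

  `M_{pq}(v) = ∑_{ω ∈ {±1}^n} σ_pσ_q ∏_i (1 + [σ agrees on edge i]·v_{cls i})`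
            `= ∑_ω σ_pσ_q ∏_c (1+v_c)^{sat_c(ω)}`  (`esTrue`),

an integer polynomial matrix in `k` variables.  A certificate is an integer polynomial matrix `B(v)`
and an integer polynomial `d(v)` with `M·B = d·1` identically, all coefficients of `d` `≥ 0` and
`d(0) > 0`, and all coefficients of the off-diagonal entries of `B` `≤ 0`; then `(Σ⁻¹)_{xy} ≤ 0` for
every nonnegative coupling vector (`inv_entry_nonpos_of_checkCoreG`).

Polynomials in `k` variables are `k`-fold nested dense coefficient lists.  The arithmetic and the
checks are written ONCE, generically in a record `LOps α` of coefficient operations, and lifted one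
variable at a time (`LOps.up`); soundness is proved against an abstract evaluation satisfying
`LOps.Sem`, which also lifts (`LOps.up_sem`, at a point `x ≥ 0`).  The core checker `checkCoreG`
is `checkSymCore` made generic, with one addition: automorphisms used to transport row identities
must preserve the edge classes (`clsPermOK`).  The level files (`…MultiTwo`, …) supply the
enumeration of the rows of `M` at a fixed number of classes. [cite: FriedliVelenik2017, §3.8.1]
-/

namespace Literature.Probability.LatticeModels

namespace IsingPolynomial

open Finset Matrix

/-! ### Coefficient operations and their lift to one more variable -/

/-- The operations on a coefficient domain used by the generic polynomial arithmetic. [folklore] -/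
structure LOps (α : Type) where
  /-- sum -/
  add : α → α → α
  /-- product -/
  mul : α → α → α
  /-- zero -/
  zero : α
  /-- equality test (as polynomials) -/
  eqv : α → α → Bool
  /-- all coefficients `≥ 0` -/
  nonneg : α → Bool
  /-- all coefficients `≤ 0` -/
  nonpos : α → Bool
  /-- all coefficients `≥ 0` and constant coefficient `> 0` -/
  pos : α → Bool

/-- Integer coefficients. [folklore] -/
def zOps : LOps ℤ where
  add a b := a + b
  mul a b := a * b
  zero := 0
  eqv a b := a == b
  nonneg a := decide (0 ≤ a)
  nonpos a := decide (a ≤ 0)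
  pos a := decide (0 < a)

section Generic

variable {α : Type}

/-- Sum of dense coefficient lists (low degree first). [folklore] -/
def gadd (o : LOps α) : List α → List α → List α
  | [], q => q
  | c :: cs, [] => c :: cs
  | c :: cs, e :: es => o.add c e :: gadd o cs es

/-- Multiple of a coefficient list by a coefficient. [folklore] -/
def gcmul (o : LOps α) (a : α) : List α → List α
  | [] => []
  | c :: cs => o.mul a c :: gcmul o a cs

/-- Product of coefficient lists. [folklore] -/
def gmul (o : LOps α) : List α → List α → List α
  | [], _ => []
  | c :: cs, q => gadd o (gcmul o c q) (o.zero :: gmul o cs q)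

/-- All coefficients are zero. [folklore] -/
def gIsZero (o : LOps α) (p : List α) : Bool := p.all fun c => o.eqv c o.zero

/-- Equality as polynomials (trailing zeros ignored). [folklore] -/
def gEq (o : LOps α) : List α → List α → Bool
  | [], q => gIsZero o q
  | c :: cs, [] => gIsZero o (c :: cs)
  | c :: cs, e :: es => o.eqv c e && gEq o cs es

/-- The constant coefficient is positive. [folklore] -/
def gPosHead (o : LOps α) : List α → Bool
  | [] => false
  | c :: _ => o.pos c

/-- Sum of a list of coefficients. [folklore] -/
def gsum (o : LOps α) : List α → α
  | [] => o.zero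
  | a :: as => o.add a (gsum o as)

/-- The lift of coefficient operations to coefficient lists (one more variable). [folklore] -/
def LOps.up (o : LOps α) : LOps (List α) where
  add := gadd o
  mul := gmul o
  zero := []
  eqv := gEq o
  nonneg p := p.all o.nonneg
  nonpos p := p.all o.nonpos
  pos p := p.all o.nonneg && gPosHead o p

/-- Evaluation of a coefficient list at `x`, the coefficients being evaluated by `ev`. [folklore] -/
def geval (ev : α → ℝ) : List α → ℝ → ℝ
  | [], _ => 0
  | c :: cs, x => ev c + x * geval ev cs x

/-- What soundness needs of an evaluation `ev` of the coefficient domain: it is a "ring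
homomorphism" for `add`/`mul`/`zero`, respects `eqv`, and the sign tests are correct. [folklore] -/
structure LOps.Sem (o : LOps α) (ev : α → ℝ) : Prop where
  /-- additivity -/
  add : ∀ a b, ev (o.add a b) = ev a + ev b
  /-- multiplicativity -/
  mul : ∀ a b, ev (o.mul a b) = ev a * ev b
  /-- zero -/
  zero : ev o.zero = 0
  /-- the equality test is sound -/
  eqv : ∀ a b, o.eqv a b = true → ev a = ev b
  /-- the nonnegativity test is sound -/
  nonneg : ∀ a, o.nonneg a = true → 0 ≤ ev a
  /-- the nonpositivity test is sound -/
  nonpos : ∀ a, o.nonpos a = true → ev a ≤ 0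
  /-- the positivity test is sound -/
  pos : ∀ a, o.pos a = true → 0 < ev a

/-- The integer operations are sound for the cast to `ℝ`. [folklore] -/
theorem zOps_sem : zOps.Sem (fun z : ℤ => (z : ℝ)) where
  add a b := by simp [zOps]
  mul a b := by simp [zOps]
  zero := by simp [zOps]
  eqv a b h := by
    simp only [zOps, beq_iff_eq] at h
    rw [h]
  nonneg a h := by
    simp only [zOps, decide_eq_true_eq] at h
    exact_mod_cast h
  nonpos a h := by
    simp only [zOps, decide_eq_true_eq] at h
    exact_mod_cast h
  pos a h := by
    simp only [zOps, decide_eq_true_eq] at h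
    exact_mod_cast h

/-- `geval` of integer coefficients is `leval`. [folklore] -/
theorem geval_int_eq_leval (p : List ℤ) (x : ℝ) : geval (fun z : ℤ => (z : ℝ)) p x = leval p x := by
  induction p with
  | nil => rfl
  | cons c cs ih => simp [geval, ih]

section UpSem

variable {o : LOps α} {ev : α → ℝ} (hs : o.Sem ev) (x : ℝ)
include hs

/-- `geval` is additive. [folklore] -/
theorem geval_gadd (p q : List α) : geval ev (gadd o p q) x = geval ev p x + geval ev q x := by
  induction p generalizing q with
  | nil => simp [gadd, geval]
  | cons c cs ih =>
    cases q with
    | nil => simp [gadd, geval]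
    | cons e es => simp only [gadd, geval, ih, hs.add]; ring

/-- `geval` commutes with coefficient multiples. [folklore] -/
theorem geval_gcmul (a : α) (p : List α) : geval ev (gcmul o a p) x = ev a * geval ev p x := by
  induction p with
  | nil => simp [gcmul, geval]
  | cons c cs ih => simp only [gcmul, geval, ih, hs.mul]; ring

/-- `geval` is multiplicative. [folklore] -/
theorem geval_gmul (p q : List α) : geval ev (gmul o p q) x = geval ev p x * geval ev q x := by
  induction p with
  | nil => simp [gmul, geval]
  | cons c cs ih =>
    simp only [gmul, geval_gadd hs x, geval_gcmul hs x, geval, ih, hs.zero]; ring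

/-- A list of zero coefficients evaluates to `0`. [folklore] -/
theorem geval_eq_zero_of_gIsZero {p : List α} (h : gIsZero o p = true) : geval ev p x = 0 := by
  induction p with
  | nil => rfl
  | cons c cs ih =>
    simp only [gIsZero, List.all_cons, Bool.and_eq_true] at h
    have h1 : ev c = 0 := (hs.eqv _ _ h.1).trans hs.zero
    have h2 : geval ev cs x = 0 := ih h.2
    simp [geval, h1, h2]

/-- `gEq`-equal lists evaluate equally. [folklore] -/
theorem geval_eq_of_gEq {p q : List α} (h : gEq o p q = true) : geval ev p x = geval ev q x := by
  induction p generalizing q with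
  | nil => exact (geval_eq_zero_of_gIsZero hs x h).symm
  | cons c cs ih =>
    cases q with
    | nil => exact geval_eq_zero_of_gIsZero hs x h
    | cons e es =>
      simp only [gEq, Bool.and_eq_true] at h
      simp only [geval, hs.eqv _ _ h.1, ih h.2]

/-- Nonnegative coefficients give a nonnegative value at `x ≥ 0`. [folklore] -/
theorem geval_nonneg {p : List α} (h : p.all o.nonneg = true) (hx : 0 ≤ x) : 0 ≤ geval ev p x := by
  induction p with
  | nil => simp [geval]
  | cons c cs ih =>
    simp only [List.all_cons, Bool.and_eq_true] at h
    simp only [geval]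
    exact add_nonneg (hs.nonneg _ h.1) (mul_nonneg hx (ih h.2))

/-- Nonpositive coefficients give a nonpositive value at `x ≥ 0`. [folklore] -/
theorem geval_nonpos {p : List α} (h : p.all o.nonpos = true) (hx : 0 ≤ x) : geval ev p x ≤ 0 := by
  induction p with
  | nil => simp [geval]
  | cons c cs ih =>
    simp only [List.all_cons, Bool.and_eq_true] at h
    simp only [geval]
    have h1 := hs.nonpos _ h.1
    nlinarith [ih h.2]

/-- Nonnegative coefficients and a positive constant give a positive value at `x ≥ 0`. [folklore] -/
theorem geval_pos {p : List α} (h : p.all o.nonneg = true) (h0 : gPosHead o p = true) (hx : 0 ≤ x) :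
    0 < geval ev p x := by
  cases p with
  | nil => simp [gPosHead] at h0
  | cons c cs =>
    simp only [List.all_cons, Bool.and_eq_true] at h
    simp only [geval]
    exact add_pos_of_pos_of_nonneg (hs.pos _ h0) (mul_nonneg hx (geval_nonneg hs x h.2 hx))

/-- `gsum` evaluates to the sum of the evaluations. [folklore] -/
theorem ev_gsum (l : List α) : ev (gsum o l) = (l.map ev).sum := by
  induction l with
  | nil => simp [gsum, hs.zero]
  | cons a as ih => simp [gsum, hs.add, ih]

/-- **The lift of a sound evaluation, at a point `x ≥ 0`, is sound.** [folklore] -/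
theorem LOps.up_sem (hx : 0 ≤ x) : o.up.Sem (fun p => geval ev p x) where
  add := geval_gadd hs x
  mul := geval_gmul hs x
  zero := rfl
  eqv p q h := geval_eq_of_gEq hs x h
  nonneg p h := geval_nonneg hs x h hx
  nonpos p h := geval_nonpos hs x h hx
  pos p h := by
    have h' : p.all o.nonneg = true ∧ gPosHead o p = true := by
      simpa [LOps.up, Bool.and_eq_true] using h
    exact geval_pos hs x h'.1 h'.2 hx

end UpSem

/-! ### The generic core checker -/

/-- Entry `(p,q)` of a table of polynomials. [folklore] -/
def getPolyG (o : LOps α) (T : List (List α)) (p q : ℕ) : α := (T.getD p []).getD q o.zero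

/-- Entry `(p,q)` of the certificate matrix `B` (distinct entries plus an index matrix). [folklore] -/
def getBG (o : LOps α) (Bcls : List α) (Bidx : List (List ℕ)) (p q : ℕ) : α :=
  Bcls.getD ((Bidx.getD p []).getD q 0) o.zero

/-- Entry `(p,q)` of `M·B`. [folklore] -/
def prodEntryG (o : LOps α) (n : ℕ) (Mtab : List (List α)) (Bcls : List α) (Bidx : List (List ℕ))
    (p q : ℕ) : α :=
  gsum o ((List.range n).map fun r => o.mul (getPolyG o Mtab p r) (getBG o Bcls Bidx r q))

/-- `B` is invariant under the vertex permutation `pi`. [folklore] -/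
def bInvariantG (o : LOps α) (n : ℕ) (Bcls : List α) (Bidx : List (List ℕ)) (pi : List ℕ) : Bool :=
  (List.range n).all fun p => (List.range n).all fun q =>
    o.eqv (getBG o Bcls Bidx (permAt pi p) (permAt pi q)) (getBG o Bcls Bidx p q)

/-- The edge permutation `tau` preserves the edge classes. [folklore] -/
def clsPermOK (cls : List ℕ) (m : ℕ) (tau : List ℕ) : Bool :=
  (List.range m).all fun i => cls.getD (permAt tau i) 0 == cls.getD i 0

/-- The generic core checker (the caller knows that the rows `rows` of `Mtab` are the true
multivariate Edwards–Sokal rows): rows below `n`; `Mtab·B = d·1` on `rows`; `d` positive on the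
nonnegative orthant (coefficient test); off-diagonal entries of `B` nonpositive there; every
generator is a class-preserving graph automorphism leaving `B` invariant; the orbit of `rows` is
everything. [folklore] -/
def checkCoreG (o : LOps α) (n : ℕ) (E : List (ℕ × ℕ)) (cls : List ℕ) (Mtab : List (List α))
    (Bcls : List α) (Bidx : List (List ℕ)) (d : α) (rows : List ℕ) (gens : List (List ℕ × List ℕ)) :
    Bool :=
  edgesOK n E &&
  (rows.all fun p => decide (p < n)) &&
  (rows.all fun p => (List.range n).all fun q =>
      o.eqv (prodEntryG o n Mtab Bcls Bidx p q) (if p = q then d else o.zero)) &&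
  o.pos d &&
  ((List.range n).all fun p => (List.range n).all fun q =>
      (p == q) || o.nonpos (getBG o Bcls Bidx p q)) &&
  (gens.all fun g => permOK n g.1 && edgePermOK E g.1 g.2 && clsPermOK cls E.length g.2 &&
      bInvariantG o n Bcls Bidx g.1) &&
  coverAll n rows gens

end Generic

/-! ### The true multi-class Edwards–Sokal matrix and the Boltzmann weights -/

/-- The multivariate Edwards–Sokal entry as a real function of the class variables `v`:
`M_{pq}(v) = ∑_ω σ_pσ_q ∏_i (1 + [σ agrees on edge i]·v_{cls i})`. [folklore] -/
def esTrue (n : ℕ) (E : List (ℕ × ℕ)) (cls : List ℕ) (v : ℕ → ℝ) (p q : Fin n) : ℝ :=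
  ∑ ω : SpinConfig (Fin n), spinAt p ω * spinAt q ω *
    ∏ i : Fin E.length,
      (if spinN ω (E[i.1]).1 = spinN ω (E[i.1]).2 then 1 + v (cls.getD i.1 0) else (1 : ℝ))

section RealSide

variable {n : ℕ} {E : List (ℕ × ℕ)}

/-- **The unnormalised pair sum is `∏_i e^{−K_{cls i}}` times the multivariate Edwards–Sokal entry
at `v_c = e^{2K_c} − 1`.** [folklore] -/
theorem gksSum_pair_eq_cls (hE : edgesOK n E = true) (cls : List ℕ) (Kc : ℕ → ℝ) (p q : Fin n) :
    gksSum Finset.univ (fun i : Fin E.length => Kc (cls.getD i.1 0)) (edgeSet n E)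
        (fun ω => spinAt p ω * spinAt q ω) =
      (∏ i : Fin E.length, Real.exp (-Kc (cls.getD i.1 0))) *
        esTrue n E cls (fun c => Real.exp (2 * Kc c) - 1) p q := by
  rw [esTrue, gksSum, Finset.mul_sum]
  refine Finset.sum_congr rfl fun ω _ => ?_
  have hw : gksWeight Finset.univ (fun i : Fin E.length => Kc (cls.getD i.1 0)) (edgeSet n E) ω =
      (∏ i : Fin E.length, Real.exp (-Kc (cls.getD i.1 0))) *
        ∏ i : Fin E.length, (if spinN ω (E[i.1]).1 = spinN ω (E[i.1]).2
          then 1 + (Real.exp (2 * Kc (cls.getD i.1 0)) - 1) else (1 : ℝ)) := by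
    rw [gksWeight, gksHamiltonian, Real.exp_sum, ← Finset.prod_mul_distrib]
    refine Finset.prod_congr rfl fun i _ => ?_
    rw [← factor_eq hE ω (Real.exp (2 * Kc (cls.getD i.1 0)) - 1) i]
    rcases spinProduct_eq_one_or (edgeSet n E i) ω with hs | hs <;> rw [hs]
    · have h : Real.exp (-Kc (cls.getD i.1 0)) * Real.exp (2 * Kc (cls.getD i.1 0)) =
          Real.exp (Kc (cls.getD i.1 0) * 1) := by
        rw [← Real.exp_add]; congr 1; ring
      rw [← h]; ring
    · rw [show Kc (cls.getD i.1 0) * -1 = -Kc (cls.getD i.1 0) by ring]; ring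
  rw [hw]; ring

/-- **From a verified identity to the sign of the inverse (multi-class couplings).**  If
`M(v)·B = d·1` for the true multivariate Edwards–Sokal matrix at `v_c = e^{2K_c} − 1`, with `d > 0`
and `B_{xy} ≤ 0`, then `(Σ⁻¹)_{xy} ≤ 0` for the system with coupling `K_{cls i}` on edge `i`. [folklore] -/
theorem inv_entry_nonpos_of_mul_eq_cls (hE : edgesOK n E = true) (cls : List ℕ) (Kc : ℕ → ℝ)
    (Bv : Matrix (Fin n) (Fin n) ℝ) (dv : ℝ) (hd : 0 < dv)
    (hMB : (Matrix.of fun p q : Fin n => esTrue n E cls (fun c => Real.exp (2 * Kc c) - 1) p q) * Bv =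
      dv • (1 : Matrix (Fin n) (Fin n) ℝ))
    (x y : Fin n) (hB : Bv x y ≤ 0) :
    (Matrix.of fun p q : Fin n => gksExpect Finset.univ (fun i : Fin E.length => Kc (cls.getD i.1 0))
        (edgeSet n E) (fun ω => spinAt p ω * spinAt q ω))⁻¹ x y ≤ 0 := by
  set c : ℝ := ∏ i : Fin E.length, Real.exp (-Kc (cls.getD i.1 0)) with hc_def
  have hc : 0 < c := Finset.prod_pos fun i _ => Real.exp_pos _
  set Z : ℝ := gksSum Finset.univ (fun i : Fin E.length => Kc (cls.getD i.1 0)) (edgeSet n E)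
    (fun _ => 1) with hZ_def
  have hZ : 0 < Z := gksSum_one_pos _ _ _
  set Mv : Matrix (Fin n) (Fin n) ℝ :=
    Matrix.of fun p q : Fin n => esTrue n E cls (fun c => Real.exp (2 * Kc c) - 1) p q with hMv
  have hG : (Matrix.of fun p q : Fin n => gksExpect Finset.univ
      (fun i : Fin E.length => Kc (cls.getD i.1 0)) (edgeSet n E) (fun ω => spinAt p ω * spinAt q ω)) =
      (Z⁻¹ * c) • Mv := by
    ext p q
    simp only [Matrix.of_apply, Matrix.smul_apply, smul_eq_mul, hMv, gksExpect]
    rw [gksSum_pair_eq_cls hE cls Kc p q, ← hZ_def, div_eq_inv_mul]; ring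
  have hinv : ((Z⁻¹ * c) • Mv)⁻¹ = ((Z⁻¹ * c)⁻¹ * dv⁻¹) • Bv := by
    apply Matrix.inv_eq_right_inv
    rw [Matrix.smul_mul, Matrix.mul_smul, hMB, smul_smul, smul_smul]
    rw [show Z⁻¹ * c * ((Z⁻¹ * c)⁻¹ * dv⁻¹) * dv = 1 by field_simp]
    exact one_smul _ _
  rw [hG, hinv, Matrix.smul_apply, smul_eq_mul]
  exact mul_nonpos_of_nonneg_of_nonpos (by positivity) hB

/-- **The true multivariate Edwards–Sokal matrix is invariant under class-preserving graph
automorphisms.** [folklore] -/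
theorem esTrue_perm_invariant {cls : List ℕ} {pi tau : List ℕ} (hE : edgesOK n E = true)
    (hpi : permOK n pi = true) (htau : edgePermOK E pi tau = true)
    (hcls : clsPermOK cls E.length tau = true) (v : ℕ → ℝ) (p q : Fin n) :
    esTrue n E cls v (permEquiv pi hpi p) (permEquiv pi hpi q) = esTrue n E cls v p q := by
  unfold esTrue
  conv_rhs => rw [← Equiv.sum_comp ((permEquiv pi hpi).symm.arrowCongr (Equiv.refl ℤˣ))]
  refine Finset.sum_congr rfl fun ω _ => ?_
  have hcomp : ((permEquiv pi hpi).symm.arrowCongr (Equiv.refl ℤˣ)) ω = ω ∘ permEquiv pi hpi := by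
    ext a; simp [Equiv.arrowCongr_apply]
  rw [hcomp,
    show spinAt p (ω ∘ ⇑(permEquiv pi hpi)) = spinAt (permEquiv pi hpi p) ω from rfl,
    show spinAt q (ω ∘ ⇑(permEquiv pi hpi)) = spinAt (permEquiv pi hpi q) ω from rfl]
  congr 1
  have hcls' : ∀ i : Fin E.length, cls.getD (edgeEquiv pi tau htau i).1 0 = cls.getD i.1 0 := by
    intro i
    have := List.all_eq_true.1 hcls i.1 (List.mem_range.2 i.2)
    have h2 : (edgeEquiv pi tau htau i).1 = permAt tau i.1 := rfl
    rw [h2]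
    simpa using this
  symm
  calc (∏ i : Fin E.length, (if spinN (ω ∘ permEquiv pi hpi) (E[i.1]).1 =
          spinN (ω ∘ permEquiv pi hpi) (E[i.1]).2 then 1 + v (cls.getD i.1 0) else (1 : ℝ)))
      = ∏ i : Fin E.length, (if spinN ω (E[(edgeEquiv pi tau htau i).1]).1 =
          spinN ω (E[(edgeEquiv pi tau htau i).1]).2
          then 1 + v (cls.getD (edgeEquiv pi tau htau i).1 0) else (1 : ℝ)) := by
        refine Finset.prod_congr rfl fun i _ => ?_
        rw [factor_comp hE hpi htau ω (v (cls.getD i.1 0)) i, hcls' i]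
    _ = ∏ j : Fin E.length, (if spinN ω (E[j.1]).1 = spinN ω (E[j.1]).2
          then 1 + v (cls.getD j.1 0) else (1 : ℝ)) :=
        Equiv.prod_comp (edgeEquiv pi tau htau) (fun j : Fin E.length =>
          if spinN ω (E[j.1]).1 = spinN ω (E[j.1]).2 then 1 + v (cls.getD j.1 0) else (1 : ℝ))

end RealSide

/-! ### Soundness of the generic core checker -/

section CoreSound

variable {α : Type} {o : LOps α} {ev : α → ℝ} {n : ℕ} {E : List (ℕ × ℕ)} {cls : List ℕ}
  {Mtab : List (List α)} {Bcls : List α} {Bidx : List (List ℕ)} {d : α} {rows : List ℕ}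
  {gens : List (List ℕ × List ℕ)}

/-- **Soundness of the core checker, abstract form**: if `checkCoreG` accepts and the rows `rows` of
`Mtab` evaluate (under a sound evaluation `ev`) to the true Edwards–Sokal rows at `v`, then
`M(v)·B = d·1` with `d > 0` and `B_{xy} ≤ 0` off the diagonal. [folklore] -/
theorem mul_eq_of_checkCoreG (hs : o.Sem ev)
    (h : checkCoreG o n E cls Mtab Bcls Bidx d rows gens = true) (v : ℕ → ℝ)
    (hM : ∀ p ∈ rows, ∀ (hp : p < n) (q : Fin n), ev (getPolyG o Mtab p q) = esTrue n E cls v ⟨p, hp⟩ q) :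
    edgesOK n E = true ∧ 0 < ev d ∧ (∀ x y : Fin n, x ≠ y → ev (getBG o Bcls Bidx x y) ≤ 0) ∧
      (Matrix.of (esTrue n E cls v)) * (Matrix.of fun p q : Fin n => ev (getBG o Bcls Bidx p q)) =
        ev d • (1 : Matrix (Fin n) (Fin n) ℝ) := by
  simp only [checkCoreG, Bool.and_eq_true] at h
  obtain ⟨⟨⟨⟨⟨⟨hE, -⟩, hP⟩, hd⟩, hB⟩, hgens⟩, hcov⟩ := h
  have hdpos : 0 < ev d := hs.pos _ hd
  set Mv : Matrix (Fin n) (Fin n) ℝ := Matrix.of (esTrue n E cls v) with hMv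
  set Bv : Matrix (Fin n) (Fin n) ℝ := Matrix.of fun p q : Fin n => ev (getBG o Bcls Bidx p q)
    with hBv
  have hBsign : ∀ x y : Fin n, x ≠ y → ev (getBG o Bcls Bidx x y) ≤ 0 := by
    intro x y hxy
    have hBxy := all_range (all_range hB x.2) y.2
    simp only [Bool.or_eq_true, beq_iff_eq] at hBxy
    rcases hBxy with hxy' | hnp
    · exact absurd (Fin.ext hxy') hxy
    · exact hs.nonpos _ hnp
  refine ⟨hE, hdpos, hBsign, ?_⟩
  -- row identity predicate
  let Good : ℕ → Prop := fun p => ∀ (hp : p < n) (q : Fin n),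
    (Mv * Bv) ⟨p, hp⟩ q = if p = (q : ℕ) then ev d else 0
  -- (A) seed rows
  have hseed : ∀ p ∈ rows, Good p := by
    intro p hpr hp q
    have hPp := List.all_eq_true.1 hP p hpr
    have key := hs.eqv _ _ (all_range hPp q.2)
    rw [prodEntryG, ev_gsum hs, List.map_map, list_sum_range_eq, ← Fin.sum_univ_eq_sum_range] at key
    simp only [Function.comp_apply, hs.mul, hM p hpr hp] at key
    simp only [hMv, hBv, Matrix.mul_apply, Matrix.of_apply]
    rw [key]
    split_ifs
    · rfl
    · exact hs.zero
  -- (B) transport along a generator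
  have hstep : ∀ g ∈ gens, ∀ p < n, Good p → Good (permAt g.1 p) := by
    intro g hg p hp hgood hπp q
    have hg' := List.all_eq_true.1 hgens g hg
    simp only [Bool.and_eq_true] at hg'
    obtain ⟨⟨⟨hpi, htau⟩, hclsOK⟩, hBinv⟩ := hg'
    set π := permEquiv g.1 hpi with hπ
    have hπp_eq : (⟨permAt g.1 p, hπp⟩ : Fin n) = π ⟨p, hp⟩ := Fin.ext rfl
    have hBi : ∀ r s : Fin n, Bv (π r) (π s) = Bv r s := by
      intro r s
      simp only [hBv, Matrix.of_apply]
      exact hs.eqv _ _ (all_range (all_range hBinv r.2) s.2)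
    have hMi : ∀ r s : Fin n, Mv (π r) (π s) = Mv r s := by
      intro r s
      simp only [hMv, Matrix.of_apply]
      exact esTrue_perm_invariant hE hpi htau hclsOK v r s
    rw [hπp_eq, Matrix.mul_apply, ← Equiv.sum_comp π]
    have hq : q = π (π.symm q) := (Equiv.apply_symm_apply π q).symm
    conv_lhs => rw [hq]
    simp_rw [hMi, hBi]
    have := hgood hp (π.symm q)
    rw [Matrix.mul_apply] at this
    rw [this]
    have hiff : p = ((π.symm q : Fin n) : ℕ) ↔ permAt g.1 p = (q : ℕ) := by
      constructor
      · intro h1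
        have h2 : (⟨p, hp⟩ : Fin n) = π.symm q := Fin.ext h1
        have h3 : π ⟨p, hp⟩ = q := by rw [h2, Equiv.apply_symm_apply]
        exact congrArg Fin.val h3
      · intro h1
        have h2 : π ⟨p, hp⟩ = q := Fin.ext h1
        have h3 : (⟨p, hp⟩ : Fin n) = π.symm q := by rw [← h2, Equiv.symm_apply_apply]
        exact congrArg Fin.val h3
    by_cases hc : p = ((π.symm q : Fin n) : ℕ)
    · rw [if_pos hc, if_pos (hiff.1 hc)]
    · rw [if_neg hc, if_neg (mt hiff.2 hc)]
  -- (C) all rows are covered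
  have hall : ∀ p < n, Good p := by
    intro p hp
    refine coverIter_induction Good hstep n _ (fun q hq hq0 => ?_) p hp
      (List.all_eq_true.1 (by simpa [coverAll] using hcov) p (List.mem_range.2 hp))
    rw [List.getD_eq_getElem _ _ (by simpa using hq)] at hq0
    simp only [List.getElem_map, List.getElem_range, List.any_eq_true, beq_iff_eq] at hq0
    obtain ⟨r, hr, rfl⟩ := hq0
    exact hseed r hr
  ext p q
  rw [hall p p.2 p.2 q]
  simp only [Matrix.smul_apply, Matrix.one_apply, smul_eq_mul, mul_ite, mul_one, mul_zero,
    Fin.ext_iff]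

/-- **Soundness of the generic core checker**: if `checkCoreG` accepts and the rows `rows` of `Mtab`
evaluate to the true Edwards–Sokal rows at `v_c = e^{2K_c} − 1` (under a sound evaluation), then
every off-diagonal entry of the inverse of the spin second-moment matrix of the system with coupling
`K_{cls i}` on edge `i` is `≤ 0`. [folklore] -/
theorem inv_entry_nonpos_of_checkCoreG (hs : o.Sem ev)
    (h : checkCoreG o n E cls Mtab Bcls Bidx d rows gens = true) (Kc : ℕ → ℝ)
    (hM : ∀ p ∈ rows, ∀ (hp : p < n) (q : Fin n),
      ev (getPolyG o Mtab p q) = esTrue n E cls (fun c => Real.exp (2 * Kc c) - 1) ⟨p, hp⟩ q)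
    (x y : Fin n) (hxy : x ≠ y) :
    (Matrix.of fun p q : Fin n => gksExpect Finset.univ (fun i : Fin E.length => Kc (cls.getD i.1 0))
        (edgeSet n E) (fun ω => spinAt p ω * spinAt q ω))⁻¹ x y ≤ 0 := by
  obtain ⟨hE, hd, hB, hMB⟩ := mul_eq_of_checkCoreG hs h _ hM
  exact inv_entry_nonpos_of_mul_eq_cls hE cls Kc _ (ev d) hd hMB x y (hB x y hxy)

end CoreSound

end IsingPolynomial

end Literature.Probability.LatticeModels
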